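import Mathlib.NumberTheory.NumberField.Completion.FinitePlace
import HarnessLib

/-!
# The denominator ideal of an element of a number field and the finite part of the height of `[1 : ξ]`

Topic `NumberTheory/NumberFields`; namespace `Literature.NumberTheory.NumberFields`. KERNEL mathematics only
(theorems; no definition, no named fact, no `axiom`, no `sorry`; Mathlib-only imports).

For a number field `K` and `ξ ∈ K` there is a non-zero integral ideal `𝔡` of `𝓞 K` — the DENOMINATOR IDEAL
`𝔡_ξ = ∏_v 𝔭_v^{max(0, ord_v(ξ⁻¹))}` — such that
* `ξ 𝔡 ⊆ 𝓞 K` (every `d ∈ 𝔡` clears the denominator of `ξ`: `ξ d ∈ 𝓞 K`), i.e. `ξ ∈ 𝔡⁻¹`;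
* `N(𝔡) = ∏_{v ∤ ∞} max(1, |ξ|_v)` — the finite part of the classical height of the point `[1 : ξ] ∈ ℙ¹(K)`
  (`|ξ|_v = N(𝔭_v)^{-ord_v ξ}` the normalised absolute value of Mathlib's `v.adicCompletion K`).
(`exists_ideal_mul_mem_and_absNorm_eq_finprod_max_one_nnnorm`.) This is the «denominator decomposition»
`ξ ∈ 𝔡⁻¹`, `H_fin([1:ξ]) = N𝔡` by which sums over `ξ ∈ K` weighted by `H_fin^{-N}` are regrouped as
`Σ_𝔡 N𝔡^{-N} Σ_{ξ ∈ 𝔡⁻¹}` ([Garrett2018, §2.2: local heights `h_v = sup |xᵢ|_v` and the product formula;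
Weil's reduction of a lattice sum to the sub-lattices `N⁻¹ Σ ℤ aᵢ` in [Weil1965, Chap. I n° 12, proof of Lemme 5]).

Auxiliary (§1): the normalised absolute value as a power of the norm of `v`,
`‖ξ‖_v = N(v)^{log (v.valuation K ξ)}` (`nnnorm_eq_absNorm_zpow_log`), `max(1, ‖ξ‖_v) = N(v)^{max(0, log …)}`,
and the finiteness of the set of `v` with `‖ξ‖_v > 1`.

## References
* [Garrett2018] P. Garrett, *Modern Analysis of Automorphic Forms by Example* (2018), §2.2 (PDF pp. 81–82).
* [Weil1965] A. Weil, *Sur la formule de Siegel dans la théorie des groupes classiques*, Acta Math. 113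
  (1965) 1–87: Chap. I n° 12, proof of Lemme 5, pp. 21–22.
-/

set_option autoImplicit false

noncomputable section

open IsDedekindDomain IsDedekindDomain.HeightOneSpectrum NumberField NumberField.HeightOneSpectrum WithZero WithZeroMulInt
open scoped NNReal

namespace Literature.NumberTheory.NumberFields

variable {K : Type*} [Field K] [NumberField K]

/-! ## §1 The normalised absolute value at a finite place as a power of `N(v)` -/

/-- `‖ξ‖_v = N(v) ^ log (val_v ξ)` for `ξ ≠ 0` (`val_v ξ = exp (log val_v ξ)` in `ℤᵐ⁰`; integers have `log ≤ 0`).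
[cite: Garrett2018, §2.2 (PDF p. 81)] -/
theorem nnnorm_eq_absNorm_zpow_log (v : HeightOneSpectrum (𝓞 K)) {ξ : K} (hξ : ξ ≠ 0) :
    ‖(ξ : v.adicCompletion K)‖₊ =
      (Ideal.absNorm v.asIdeal : ℝ≥0) ^ (log (v.valuation K ξ)) := by
  have hval : v.valuation K ξ ≠ 0 := (Valuation.ne_zero_iff _).2 hξ
  apply NNReal.coe_injective
  rw [coe_nnnorm]
  change ‖FinitePlace.embedding v ξ‖ = _
  rw [FinitePlace.norm_embedding', toNNReal_neg_apply _ hval]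
  push_cast
  congr 1
  have h := exp_log hval
  -- `log x = toAdd (unzero hx)`: both exponentiate to `x`
  have h2 : exp (Multiplicative.toAdd (unzero hval)) = v.valuation K ξ := by
    rw [show exp (Multiplicative.toAdd (unzero hval)) = ((unzero hval : Multiplicative ℤ) : ℤᵐ⁰) from rfl,
      coe_unzero]
  have h3 : Multiplicative.toAdd (unzero hval) = log (v.valuation K ξ) := by
    have := h2.trans h.symm
    rwa [exp_inj] at this
  exact h3

/-- `1 < N(v)` in `ℝ≥0`. [folklore] -/
private theorem one_lt_absNorm' (v : HeightOneSpectrum (𝓞 K)) : (1 : ℝ≥0) < (Ideal.absNorm v.asIdeal : ℝ≥0) :=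
  one_lt_absNorm_nnreal v

/-- `max(1, ‖ξ‖_v) = N(v) ^ max(0, log val_v ξ)` for `ξ ≠ 0`. [cite: Garrett2018, §2.2 (PDF p. 81)] -/
theorem max_one_nnnorm_eq_absNorm_pow (v : HeightOneSpectrum (𝓞 K)) {ξ : K} (hξ : ξ ≠ 0) :
    max 1 ‖(ξ : v.adicCompletion K)‖₊ =
      (Ideal.absNorm v.asIdeal : ℝ≥0) ^ (max 0 (log (v.valuation K ξ))).toNat := by
  rw [nnnorm_eq_absNorm_zpow_log v hξ]
  set q : ℝ≥0 := (Ideal.absNorm v.asIdeal : ℝ≥0) with hq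
  have hq1 : 1 < q := one_lt_absNorm' v
  set m : ℤ := log (v.valuation K ξ) with hm
  rcases le_or_gt m 0 with h | h
  · -- integral at `v`: `q^m ≤ 1`
    have : max 0 m = 0 := max_eq_left h
    rw [this, Int.toNat_zero, pow_zero, max_eq_left]
    exact zpow_le_one_of_nonpos₀ hq1.le h
  · have : max 0 m = m := max_eq_right h.le
    rw [this, max_eq_right]
    · rw [← zpow_natCast]
      congr 1
      exact (Int.toNat_of_nonneg h.le).symm
    · exact one_le_zpow₀ hq1.le h.le

/-- the places where `‖ξ‖_v > 1` (equivalently `0 < log val_v ξ`) form a finite set: they divide the denominator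
of any fraction `ξ = a / b`, `a, b ∈ 𝓞 K`. [cite: Garrett2018, §2.2 (PDF p. 82)] -/
theorem finite_setOf_log_valuation_pos {ξ : K} (hξ : ξ ≠ 0) :
    {v : HeightOneSpectrum (𝓞 K) | 0 < log (v.valuation K ξ)}.Finite := by
  obtain ⟨a, b, hb, rfl⟩ := IsFractionRing.div_surjective (A := 𝓞 K) ξ
  have hb0 : (b : 𝓞 K) ≠ 0 := nonZeroDivisors.ne_zero hb
  have ha0 : (a : 𝓞 K) ≠ 0 := by
    rintro rfl
    simp at hξ
  -- `0 < log val_v (a/b)` forces `val_v b < 1`, i.e. `v ∣ (b)`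
  have hsub : {v : HeightOneSpectrum (𝓞 K) | 0 < log (v.valuation K (algebraMap (𝓞 K) K a / algebraMap (𝓞 K) K b))}
      ⊆ {v : HeightOneSpectrum (𝓞 K) | v.asIdeal ∣ Ideal.span {b}} := by
    intro v hv
    rw [Set.mem_setOf_eq] at hv ⊢
    rw [← intValuation_lt_one_iff_dvd]
    by_contra hle
    push Not at hle
    have hb1 : v.intValuation b = 1 := le_antisymm (v.intValuation_le_one b) hle
    have hva : v.valuation K (algebraMap (𝓞 K) K a / algebraMap (𝓞 K) K b) = v.intValuation a := by
      rw [map_div₀, valuation_of_algebraMap, valuation_of_algebraMap, hb1, div_one]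
    rw [hva] at hv
    have hle1 : v.intValuation a ≤ 1 := v.intValuation_le_one a
    have hne : v.intValuation a ≠ 0 := v.intValuation_ne_zero a ha0
    have : log (v.intValuation a) ≤ 0 := by
      rw [← exp_le_exp (a := log (v.intValuation a)) (b := (0 : ℤ)), exp_log hne, exp_zero]; exact hle1
    exact absurd hv (not_lt.2 this)
  exact (Ideal.finite_factors (by simpa using hb0)).subset hsub

/-! ## §2 The denominator ideal -/

/-- **The denominator ideal and the finite height.** For every `ξ ∈ K` there is a non-zero ideal `𝔡 ⊆ 𝓞 K` with
`ξ 𝔡 ⊆ 𝓞 K` (so `ξ ∈ 𝔡⁻¹`) and `N(𝔡) = ∏_{v ∤ ∞} max(1, ‖ξ‖_v)`; explicitly `𝔡 = ∏_{‖ξ‖_v > 1} 𝔭_v^{log val_v ξ}`.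
[cite: Garrett2018, §2.2 (PDF pp. 81–82)] [cite: Weil1965, Chap. I n° 12, proof of Lemme 5, pp. 21–22] -/
theorem exists_ideal_mul_mem_and_absNorm_eq_finprod_max_one_nnnorm (ξ : K) :
    ∃ 𝔡 : Ideal (𝓞 K), 𝔡 ≠ ⊥ ∧ (∀ d ∈ 𝔡, ∃ c : 𝓞 K, ξ * (d : K) = c) ∧
      ((Ideal.absNorm 𝔡 : ℕ) : ℝ≥0) =
        ∏ᶠ v : HeightOneSpectrum (𝓞 K), max 1 ‖(ξ : v.adicCompletion K)‖₊ := by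
  classical
  by_cases hξ : ξ = 0
  · refine ⟨⊤, by simp, fun d _ => ⟨0, by simp [hξ]⟩, ?_⟩
    rw [Ideal.absNorm_top, Nat.cast_one]
    symm
    refine finprod_eq_one_of_forall_eq_one fun v => ?_
    rw [hξ]
    change max 1 ‖FinitePlace.embedding v (0 : K)‖₊ = 1
    rw [map_zero, nnnorm_zero, max_eq_left zero_le_one]
  -- exponents and the finite set of bad places
  set m : HeightOneSpectrum (𝓞 K) → ℤ := fun v => log (v.valuation K ξ) with hm
  have hfin := finite_setOf_log_valuation_pos (K := K) hξ
  set S : Finset (HeightOneSpectrum (𝓞 K)) := hfin.toFinset with hS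
  have hmemS : ∀ v, v ∈ S ↔ 0 < m v := fun v => by rw [hS, Set.Finite.mem_toFinset, Set.mem_setOf_eq]
  set e : HeightOneSpectrum (𝓞 K) → ℕ := fun v => (max 0 (m v)).toNat with he
  have he_of_not : ∀ v, v ∉ S → e v = 0 := fun v hv => by
    rw [hmemS, not_lt] at hv
    simp [he, max_eq_left hv]
  have he_of_mem : ∀ v, v ∈ S → (e v : ℤ) = m v := fun v hv => by
    rw [hmemS] at hv
    simp [he, max_eq_right hv.le, Int.toNat_of_nonneg hv.le]
  -- the denominator ideal
  set 𝔡 : Ideal (𝓞 K) := ∏ v ∈ S, v.asIdeal ^ e v with h𝔡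
  have h𝔡ne : 𝔡 ≠ ⊥ := by
    rw [h𝔡]
    exact Finset.prod_ne_zero_iff.2 fun v _ => pow_ne_zero _ v.ne_bot
  refine ⟨𝔡, h𝔡ne, fun d hd => ?_, ?_⟩
  · -- `ξ d` is integral: its valuation is `≤ 1` at every `v`
    have hint : ∀ v : HeightOneSpectrum (𝓞 K), v.valuation K (ξ * (d : K)) ≤ 1 := by
      intro v
      have hvalξ : v.valuation K ξ ≠ 0 := (Valuation.ne_zero_iff _).2 hξ
      rw [map_mul, show ((d : 𝓞 K) : K) = algebraMap (𝓞 K) K d from rfl, valuation_of_algebraMap,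
        ← exp_log hvalξ]
      by_cases hv : v ∈ S
      · -- `d ∈ 𝔡 ⊆ v^{e v}` so `val_v d ≤ exp (-e v)`, and `e v = m v`
        have hdv : d ∈ v.asIdeal ^ e v := by
          have hle : 𝔡 ≤ v.asIdeal ^ e v := by
            rw [h𝔡, ← Finset.prod_erase_mul _ _ hv]
            exact Ideal.mul_le_left
          exact hle hd
        have h1 : v.intValuation d ≤ exp (-(e v : ℤ)) := (intValuation_le_pow_iff_mem v d (e v)).2 hdv
        calc exp (m v) * v.intValuation d ≤ exp (m v) * exp (-(e v : ℤ)) :=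
              mul_le_mul_right h1 _
          _ = 1 := by rw [← exp_add, he_of_mem v hv, add_neg_cancel, exp_zero]
      · have h0 : m v ≤ 0 := by rw [hmemS, not_lt] at hv; exact hv
        calc exp (m v) * v.intValuation d ≤ exp (0 : ℤ) * 1 :=
              mul_le_mul' (exp_le_exp.2 h0) (v.intValuation_le_one d)
          _ = 1 := by rw [exp_zero, one_mul]
    obtain ⟨c, hc⟩ := mem_integers_of_valuation_le_one K (ξ * (d : K)) hint
    exact ⟨c, hc.symm⟩
  · -- the norm: both sides are `∏_{v ∈ S} N(v)^{e v}`
    have hN : ((Ideal.absNorm 𝔡 : ℕ) : ℝ≥0) = ∏ v ∈ S, (Ideal.absNorm v.asIdeal : ℝ≥0) ^ e v := by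
      rw [h𝔡, map_prod]
      push_cast
      exact Finset.prod_congr rfl fun v _ => by rw [map_pow]; push_cast; rfl
    have hsupp : (Function.mulSupport fun v : HeightOneSpectrum (𝓞 K) =>
        max 1 ‖(ξ : v.adicCompletion K)‖₊) ⊆ S := by
      intro v hv
      rw [Function.mem_mulSupport, max_one_nnnorm_eq_absNorm_pow v hξ] at hv
      by_contra hvS
      exact hv (by rw [show (max 0 (log (v.valuation K ξ))).toNat = e v from rfl, he_of_not v hvS, pow_zero])
    rw [hN, finprod_eq_prod_of_mulSupport_subset _ hsupp]
    exact Finset.prod_congr rfl fun v _ => (max_one_nnnorm_eq_absNorm_pow v hξ).symm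

end Literature.NumberTheory.NumberFields
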